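import Summits.QuantumFields.YangMills.Theorems.BalabanUVNodesN12AtRecord13Sep
import Literature.MathematicalPhysics.QuantumFieldTheory.Balaban1983to89.Node00.Record13CarriersSepMixed

/-!
# BalabanUVNodes ∕ N12 — N12's STAGE-13 COROLLARIES AND STOREY RE-KEYED TO node00-def-T's v1.3 RECORD (`Provisos₁₃SepMixed`, `datumOfRecord₁₃SepMixed`,
# `IsRecordOfRecord₁₃CSepMixed`; sibling module `Node00/Record13SepMixed`) — THE ⁵ EDITION (Track A, DAG node N12 = [B15, Balaban1989LargeFieldI] CMP **122** (1989)
# 175–202; cluster K1 (K1⁗ `StabilityBAtRecordR13Sep` = stmt-QuantumFields-20290; the v1.3 `SepMixed` record is a SIBLING edition — director-ym №150: rev 20 keys on def-T's v1.4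
# successor, to which this file re-keys by suffix); seat `pub-ymgap-dag-n12-d`
# g9 (R134 s2 «knit at the record»; HANDOFF trigger t24), 2026-08-27; count-neutral, NOT a discharge)

HONEST FRAMING.  Count-neutral kernel RE-KEYING BY NAME under node00-def-T's token map for RECORD 13 v1.3 (`KEYMAP-Record13-v1.3.md`: every v1.2 `…Sep` name of §9 ↦ the
`…SepMixed` name of the sibling module `Node00/Record13SepMixed` — `Provisos₁₃Sep ↦ Provisos₁₃SepMixed`, `datumOfRecord₁₃Sep ↦ datumOfRecord₁₃SepMixed`, `IsRecordOfRecord₁₃CSep ↦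
IsRecordOfRecord₁₃CSepMixed`; `Provisos₁₃Core` ∕ `datumOfRecord₁₃Core` UNCHANGED) over this seat's 12G `…N12AtRecord13Sep` (§1: the CORE-keyed generic-`θ` [IV] rows — NOT re-declared,
imported), 12E `…N12AtRecord13OfResiduals` (the proviso-FREE rows at a live re-pin carrying K0b's residuals) and dag-n10-d's `Node00/Record13CarriersSepMixed` (`Provisos₁₃SepMixed.pinW`,
`datumOfRecord₁₃SepMixed_pinW : rfl`, p511721).  v1.3 (p511029; director-ym №150: a sibling edition, the route's rev-20 key being def-T's v1.4 successor) moves ONLY row P11 `bg` (its support is now guarded by separation, print's (7) smallness on the mixed data and the (1.9) class condition at the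
record's minimiser); N12's rows read of the record ONLY def-R's integrable (0.3) provisos `rstep` — a field of the unchanged CORE — so for N12 the re-key is purely nominal: §1 states the
⁵-keyed corollaries of 12G §1 at `hP.toCore`, §2 the N12 storey in the v1.3 vocabulary (12G §3 verbatim under the map).  Nothing of Bałaban's is asserted or proved; NO estimate; the
(1.100) pin equation, the denominator masses ∕ live-mass, the fibre witness, Proposition 1 (1.78), (1.80), (1.89) stay DISPLAYED exactly as in 12A ∕ 12E ∕ 12G; N12 is NOT discharged;
counts unmoved (Track A discharged 5∕28).  ONE finite four-torus programme at fixed `ε = L^{-K}` — nothing continuum ∕ ℝ⁴ ∕ OS ∕ mass gap ∕ Clay.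

WHAT THIS FILE GIVES (all count-neutral; every input LANDED; the four-pin ⁵ sockets over dag-n24-c's 40⁵ are the sibling module `…N12AtRecord13SepMixedSockets`):
* §1 ⁵-KEYED COROLLARIES: `b15Leaf_WOfRecord₁₃_of_massSel_sepMixed` ∕ `rBasicStep_view₁₃B10YZW_of_massSel_sepMixed` (`(hP : θ.Provisos₁₃SepMixed F N)`, 12G §1 at `hP.toCore`).
* §2 N12's ₁₃ STOREY IN THE v1.3 VOCABULARY: `exists_record₁₃CSepMixed_pinWWorld_b15_main_of_leaf` (for every admissible `θ` with `h : Provisos₁₃SepMixed` and ANY per-run [IV] bundle family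
  `W₀` with the leaf, the world bound at the C-binding of `(θ.pinW W₀).toStage5₁₃` is an `IsRecordOfRecord₁₃CSepMixed` record of `datumOfRecord₁₃SepMixed θ h` with `Dag.B15_main` at every
  run — HONESTY: junk-inhabitable at a degenerate `W₀`, kernel census `exists_pinWWorld_b15_main_degenerate` from this seat's g4 `exists_printedCarriers15_b15Leaf`), `…_of_leafOfRecord`
  (W READ AT THE BUNDLE OF RECORD `WOfRecord₁₃ θ λ`, the row handed), `…_toSepMixed` ∕ `…_toSepMixed_sep` (a ‴- ∕ ⁗-keyed `h` plus the v1.3 letters `hM`, `hM₁`, along def-T's `Provisos₁₃.toSepMixed` ∕ `Provisos₁₃Sep.toSepMixed`), ★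
  `exists_record₁₃CSepMixed_pinWWorld_b15_main_liveRepin₁₃_of_massLive_of_hasResiduals` (at the ₁₃ live re-pin of a `Θ` carrying K0b's residuals, N12's row from its PER-RUN DISPLAYS
  by 12E), ★★ `exists_guarded_record₁₃CSepMixed_b15_main_liveRepin₁₃_of_massLive_of_hasResiduals` (the rung-1 ∃-shape of the K1 skeleton — plan g67's `stub_nodes13P` under the map —
  RESTRICTED TO N12's CONJUNCT, guard a THEOREM of K0b ∕ K0a FILE 9 v1.1 — no proviso read), ★★★ `exists_guarded_record₁₃CSepMixed_b15_main_theta13OfThm1C_of_massLive` (the same at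
  the plan's witness `θ₁₅ᶜ`: K1-side input `h : Provisos₁₃SepMixed θ₁₅ᶜ` ALONE).
WHAT N12 THEN COSTS per run at a v1.3 record (typing strength, NOT a second gap; unchanged from 12E ∕ 12F ∕ 12G ∕ 12I): live-mass at level `kSel P + 1` (NODE 00), Prop. 1 at `λ.LF P`,
(1.80) ∕ (1.89) at `λ.D189 P` (or their pinned discharges of 14C ∕ 12F ∕ 12I), the (1.100) pin equation (`rfl` at `λ.pinRPrime₁₃ θ`), and on runs with `K ≤ kSel P` the leaf itself.

Sources: [Balaban1989LargeFieldI] (0.2)–(0.6) p.176, p.176 ll.14–16, Prop. 1 (1.78) p.194, (1.80) p.195, (1.89) p.198, (1.99)–(1.102) pp.200–201; [Balaban1988Convergent] (2.18) p.257,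
(3.25) p.270; [Balaban1989LargeFieldII] Thm 1 + (0.1) pp.355–356, (7) p.278 (the record's mixed-data range; bookkeeping).
-/

noncomputable section
noncomputable section

open MeasureTheory
open scoped Matrix.Norms.L2Operator

namespace Summit.QuantumFields.YangMills.BalabanUVNodes.N12AtRecord13SepMixed

open Literature.MathematicalPhysics.QuantumFieldTheory.Balaban1983to89
open Literature.MathematicalPhysics.QuantumFieldTheory.Balaban1983to89.T4Continuum (T4Family)
open Literature.MathematicalPhysics.QuantumFieldTheory.Balaban1983to89.DagBinding
open Literature.MathematicalPhysics.QuantumFieldTheory.Balaban1983to89.Node00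
open B15Claim189Assembly (new189 chiPP dom)
open B15 (Prop1Printed Ineq180)
open B15.BasicStep (Claim189)
open B15Sect1Statements (Normalization1102)
open B8Eq17ClassAkV1 (plaqsOf)
open B15RPrime1100OfRep (rPrimeDataOfSel)
open Summit.QuantumFields.YangMills.BalabanUVNodes.N12AtRecord13Sep (b15Leaf_WOfRecord₁₃_of_massSel_core rBasicStep_view₁₃B10YZW_of_massSel_core)

variable {N : ℕ} [NeZero N] {F : T4Family}

/-! ## §1 THE ⁵-KEYED COROLLARIES (`(hP : θ.Provisos₁₃SepMixed F N)`, 12G §1 at `hP.toCore`) — what a closer at a v1.3 record calls by name -/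

section SepMixed
variable (θ : Stage13Params F N) (lam : ResidW F N)

/-- **★ THE [IV] LEAF AT THE STAGE-13 BUNDLE OF RECORD FROM THE v1.3 PROVISOS `Provisos₁₃SepMixed`** (`kSel P < P.K`; 12G §1 at `hP.toCore` — row P11's guarded support is never read by
N12): the ⁵ twin of 12A ★★ `b15Leaf_WOfRecord₁₃_of_massSel` ∕ 12G `…_sep`. [cite: Balaban1989LargeFieldI, (0.2)–(0.6) p.176, p.176 ll.14–16, Prop. 1 (1.78) p.194, (1.80) p.195, (1.89) p.198, (1.99)–(1.102) pp.200–201; Balaban1988Convergent, (3.25) p.270] -/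
theorem b15Leaf_WOfRecord₁₃_of_massSel_sepMixed (hP : θ.Provisos₁₃SepMixed F N) {P : B12.RunParams} (hk : lam.kSel P < P.K)
    (hpin : lam.D1100 P
      = rPrimeDataOfSel (reprTOfRecord₁₃ F N θ P (lam.kSel P)) (θ.ppSel P (gOfRecord₁₃ F N θ P) (lam.kSel P + 1))
          (fibOfSeq F θ.ν θ.τ9 P (gOfRecord₁₃ F N θ P) (lam.kSel P + 1)))
    (hmassSel : ∀ s, 0 < ∫ V, rterm (reprTOfRecord₁₃ F N θ P (lam.kSel P)) (θ.ppSel P (gOfRecord₁₃ F N θ P) (lam.kSel P + 1) s) V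
      ∂(fieldMeasure (F.P P.K) (lam.kSel P + 1) (SU N)))
    (hfib : ∀ s, ∃ s', θ.ppSel P (gOfRecord₁₃ F N θ P) (lam.kSel P + 1) s' = θ.ppSel P (gOfRecord₁₃ F N θ P) (lam.kSel P + 1) s ∧
      0 < ∫ V, rterm (reprTOfRecord₁₃ F N θ P (lam.kSel P)) s' V ∂(fieldMeasure (F.P P.K) (lam.kSel P + 1) (SU N)))
    (hP1 : Prop1Printed (lam.LF P))
    (h180 : ∀ U, new189 (lam.D189 P) U → ∀ i, (lam.D189 P).h ≤ i → i ≤ (lam.D189 P).k → ∀ q ∈ plaqsOf (dom (lam.D189 P) i),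
      Ineq180 ((lam.D189 P).dev0 U q) ((lam.D189 P).ε (lam.D189 P).k) (lam.D189 P).η (lam.D189 P).B₃ (lam.D189 P).B₅ (lam.D189 P).M (lam.D189 P).δ
        ((lam.D189 P).dist q) (lam.D189 P).O1)
    (h189 : Claim189 (new189 (lam.D189 P)) (chiPP (lam.D189 P))) : B15Leaf (WOfRecord₁₃ F N θ lam P) :=
  b15Leaf_WOfRecord₁₃_of_massSel_core θ lam hP.toCore hk hpin hmassSel hfib hP1 h180 h189

/-- **THE `rBasicStep` LEAF OF THE FOUR-PIN STAGE-13 VIEW FROM THE v1.3 PROVISOS** (12G §1 at `hP.toCore`). [cite: Balaban1989LargeFieldI, (0.2)–(0.6) p.176, Prop. 1 (1.78) p.194, (1.80) p.195, (1.89) p.198, (1.99)–(1.102) pp.200–201; Balaban1989LargeFieldII, Thm 1 + (0.1) pp.355–356] -/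
theorem rBasicStep_view₁₃B10YZW_of_massSel_sepMixed (hP : θ.Provisos₁₃SepMixed F N) (Mstar : ℕ) (ops : OpsY N θ.toStage3Params Mstar) (ζ : ResidZ F N)
    {P : B12.RunParams} (hk : lam.kSel P < P.K)
    (hpin : lam.D1100 P
      = rPrimeDataOfSel (reprTOfRecord₁₃ F N θ P (lam.kSel P)) (θ.ppSel P (gOfRecord₁₃ F N θ P) (lam.kSel P + 1))
          (fibOfSeq F θ.ν θ.τ9 P (gOfRecord₁₃ F N θ P) (lam.kSel P + 1)))
    (hmassSel : ∀ s, 0 < ∫ V, rterm (reprTOfRecord₁₃ F N θ P (lam.kSel P)) (θ.ppSel P (gOfRecord₁₃ F N θ P) (lam.kSel P + 1) s) V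
      ∂(fieldMeasure (F.P P.K) (lam.kSel P + 1) (SU N)))
    (hfib : ∀ s, ∃ s', θ.ppSel P (gOfRecord₁₃ F N θ P) (lam.kSel P + 1) s' = θ.ppSel P (gOfRecord₁₃ F N θ P) (lam.kSel P + 1) s ∧
      0 < ∫ V, rterm (reprTOfRecord₁₃ F N θ P (lam.kSel P)) s' V ∂(fieldMeasure (F.P P.K) (lam.kSel P + 1) (SU N)))
    (hP1 : Prop1Printed (lam.LF P))
    (h180 : ∀ U, new189 (lam.D189 P) U → ∀ i, (lam.D189 P).h ≤ i → i ≤ (lam.D189 P).k → ∀ q ∈ plaqsOf (dom (lam.D189 P) i),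
      Ineq180 ((lam.D189 P).dev0 U q) ((lam.D189 P).ε (lam.D189 P).k) (lam.D189 P).η (lam.D189 P).B₃ (lam.D189 P).B₅ (lam.D189 P).M (lam.D189 P).δ
        ((lam.D189 P).dist q) (lam.D189 P).O1)
    (h189 : Claim189 (new189 (lam.D189 P)) (chiPP (lam.D189 P))) :
    (upOfRecord₅C F N (θ.view₁₃B10YZW F N Mstar ops ζ lam) P).rBasicStep :=
  rBasicStep_view₁₃B10YZW_of_massSel_core θ lam hP.toCore Mstar ops ζ hk hpin hmassSel hfib hP1 h180 h189

end SepMixed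

/-! ## §2 N12's ₁₃ STOREY IN THE v1.3 VOCABULARY — «an `IsRecordOfRecord₁₃CSepMixed` record of θ's OWN `datumOfRecord₁₃SepMixed` with `Dag.B15_main` at every run» at the C-binding of the
W-PINNED Stage-13 view, W READ AT THE BUNDLE OF RECORD; at a live re-pin carrying K0b's residuals N12's row from its per-run displays and the guard a THEOREM -/

section Storey
variable (θ : Stage13Params F N)

/-- **FOR EVERY ADMISSIBLE STAGE-13 PACKAGE WITH THE v1.3 PROVISOS AND ANY PER-RUN [IV] BUNDLE FAMILY `W₀` CARRYING THE LEAF, THE WORLD BOUND AT THE C-BINDING OF THE W-PINNED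
STAGE-13 VIEW IS A v1.3 ₁₃C RECORD OF θ's OWN v1.3 DATUM WITH `Dag.B15_main` AT EVERY RUN** (any window `γw ∈ ]0, θ.γ]`, block size `θ.L`; the pin is UP-SIDE — dag-n10-d's
`Provisos₁₃SepMixed.pinW`, `datumOfRecord₁₃SepMixed_pinW : rfl`, `pinW_admissible_iff`, node00-def-T's eight-tuple `IsRecordOfRecord₁₃CSepMixed`; N12 reads `W₀` there: g30's
`upOfRecord₅C_pinW_rBasicStep_iff` along `toStage5₁₃_pinW`).  HONESTY (R433 species, this seat's g4 `exists_printedCarriers15_b15Leaf`): at a GENERIC `W₀` the leaf is junk-inhabitable —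
the contentful instances read `W₀ := WOfRecord₁₃ θ λ` (below).  N12's conjunct of the K1-class item at this record modulo the leaf and the other nodes at the SAME world; count-neutral.
[cite: Balaban1989LargeFieldI, (0.2)–(0.6) p.176, Prop. 1 p.194; Balaban1989LargeFieldII, Thm 1 + (0.1) pp.355–356 (the record, separated mixed-data range; bookkeeping)] -/
theorem exists_record₁₃CSepMixed_pinWWorld_b15_main_of_leaf (h : θ.Provisos₁₃SepMixed F N) (hθ : θ.Admissible F N) (W₀ : B12.RunParams → PrintedCarriers15)
    {γw : ℝ} (hγw : 0 < γw ∧ γw ≤ θ.γ) (hleaf : ∀ P, B15Leaf (W₀ P)) :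
    ∃ w : WorldP, IsRecordOfRecord₁₃CSepMixed F N (datumOfRecord₁₃SepMixed F N θ h) w ∧ w.γ = γw ∧ w.L = (θ.L : ℝ) ∧
      (∀ P, w.up P = upOfRecord₅C F N ((θ.pinW F N W₀).toStage5₁₃ F N) P) ∧ ∀ P : B12.RunParams, Dag.B15_main (leavesP w P) := by
  obtain ⟨w₀⟩ := nonempty_worldP
  let w : WorldP :=
    { w₀ with
      C := (datumOfRecord₁₃SepMixed F N θ h).C, γ := γw, L := (θ.L : ℝ), one_lt_L := by exact_mod_cast θ.hL.2,
      up := fun P => upOfRecord₅C F N ((θ.pinW F N W₀).toStage5₁₃ F N) P }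
  refine ⟨w, ⟨θ.pinW F N W₀, h.pinW W₀, (Stage13Params.pinW_admissible_iff F N θ W₀).2 hθ, (datumOfRecord₁₃SepMixed_pinW F N θ h W₀).symm, rfl, hγw, rfl,
    fun _ => rfl⟩, rfl, rfl, fun _ => rfl, fun P => ?_⟩
  exact B15LeafKnit.b15_main_of_up (U := upOfRecord₅C F N ((θ.pinW F N W₀).toStage5₁₃ F N) P) rfl
    ((upOfRecord₅C_pinW_rBasicStep_iff F N (θ.toStage5₁₃ F N) W₀ P).2 (hleaf P))

/-- **CENSUS (R433 species, kernel form): THE GENERIC-`W₀` STOREY IS JUNK-INHABITABLE AT EVERY ADMISSIBLE v1.3 PACKAGE** — a DEGENERATE [IV] bundle carries `B15Leaf` (this seat's g4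
`exists_printedCarriers15_b15Leaf`: empty index, empty Proposition-1 carrier, trivial (1.89) ∕ (1.102) letters), so SOME `W₀` presents a v1.3 record of `datumOfRecord₁₃SepMixed θ h` with `Dag.B15_main` at
every run WITHOUT any [IV] input.  Hence only the forms with W read AT THE BUNDLE OF RECORD (below) measure N12. [cite: Balaban1989LargeFieldI, (0.2) p.176, Prop. 1 p.194 (bookkeeping: the typed conjuncts read the carrier)] -/
theorem exists_pinWWorld_b15_main_degenerate (h : θ.Provisos₁₃SepMixed F N) (hθ : θ.Admissible F N) {γw : ℝ} (hγw : 0 < γw ∧ γw ≤ θ.γ) :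
    ∃ (W₀ : B12.RunParams → PrintedCarriers15) (w : WorldP), IsRecordOfRecord₁₃CSepMixed F N (datumOfRecord₁₃SepMixed F N θ h) w ∧ w.γ = γw ∧ w.L = (θ.L : ℝ) ∧
      (∀ P, w.up P = upOfRecord₅C F N ((θ.pinW F N W₀).toStage5₁₃ F N) P) ∧ ∀ P : B12.RunParams, Dag.B15_main (leavesP w P) := by
  obtain ⟨W, hW⟩ := N12AtRecord12Pointed.exists_printedCarriers15_b15Leaf (F.P 0)
  exact ⟨fun _ => W, exists_record₁₃CSepMixed_pinWWorld_b15_main_of_leaf θ h hθ (fun _ => W) hγw fun _ => hW⟩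

/-- **… W READ AT THE BUNDLE OF RECORD `WOfRecord₁₃ θ λ`** (dag-n10-d's `Record13Carriers.WOfRecord₁₃`: n12-a's `WOfRepr` at `Tstep rep_k` of record, the selector and the fibres
along the ₁₃ histories): the N12 row HANDED run by run. [cite: Balaban1989LargeFieldI, (0.2)–(0.6) p.176, Prop. 1 p.194, (1.80), (1.89), (1.99)–(1.102); Balaban1989LargeFieldII, Thm 1 + (0.1) pp.355–356 (bookkeeping)] -/
theorem exists_record₁₃CSepMixed_pinWWorld_b15_main_of_leafOfRecord (h : θ.Provisos₁₃SepMixed F N) (hθ : θ.Admissible F N) (lamW : ResidW F N)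
    {γw : ℝ} (hγw : 0 < γw ∧ γw ≤ θ.γ) (h12 : ∀ P, B15Leaf (WOfRecord₁₃ F N θ lamW P)) :
    ∃ w : WorldP, IsRecordOfRecord₁₃CSepMixed F N (datumOfRecord₁₃SepMixed F N θ h) w ∧ w.γ = γw ∧ w.L = (θ.L : ℝ) ∧
      (∀ P, w.up P = upOfRecord₅C F N ((θ.pinW F N (WOfRecord₁₃ F N θ lamW)).toStage5₁₃ F N) P) ∧ ∀ P : B12.RunParams, Dag.B15_main (leavesP w P) :=
  exists_record₁₃CSepMixed_pinWWorld_b15_main_of_leaf θ h hθ (WOfRecord₁₃ F N θ lamW) hγw h12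

/-- **A ‴-KEYED PACKAGE READS THE STOREY ALONG `Provisos₁₃.toSepMixed`** (same datum, node00-def-T's `datumOfRecord₁₃SepMixed_toSepMixed`): from the DEPRECATED, print-STRONGER v1.1 proviso
`h : θ.Provisos₁₃ F N` (displayed in full — the one-way map old ⇒ new; NOT a `SepMixed ⇒ ‴` face) plus the two v1.3 numerics letters `hM : ∃ a, θ.τ9.M = F.L ^ a` ([III] p.245
«M = L^m»; director-ym №145∕№147, tribunal J's cure) and `hM₁ : θ.ν.M₁ ∣ θ.τ9.M`, the v1.3 record of `datumOfRecord₁₃ F N θ h` with `Dag.B15_main` at every run (dag-n10-d's `…_toSepMixed` convention). [cite: Balaban1989LargeFieldII, Thm 1 + (0.1) pp.355–356; Balaban1989LargeFieldI, (0.2) p.176 (bookkeeping)] -/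
theorem exists_record₁₃CSepMixed_pinWWorld_b15_main_of_leafOfRecord_toSepMixed (h : θ.Provisos₁₃ F N) (hM : ∃ a : ℕ, θ.τ9.M = F.L ^ a) (hM₁ : θ.ν.M₁ ∣ θ.τ9.M)
    (hθ : θ.Admissible F N) (lamW : ResidW F N) {γw : ℝ} (hγw : 0 < γw ∧ γw ≤ θ.γ) (h12 : ∀ P, B15Leaf (WOfRecord₁₃ F N θ lamW P)) :
    ∃ w : WorldP, IsRecordOfRecord₁₃CSepMixed F N (datumOfRecord₁₃ F N θ h) w ∧ w.γ = γw ∧ w.L = (θ.L : ℝ) ∧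
      (∀ P, w.up P = upOfRecord₅C F N ((θ.pinW F N (WOfRecord₁₃ F N θ lamW)).toStage5₁₃ F N) P) ∧ ∀ P : B12.RunParams, Dag.B15_main (leavesP w P) :=
  exists_record₁₃CSepMixed_pinWWorld_b15_main_of_leafOfRecord θ (h.toSepMixed hM hM₁) hθ lamW hγw h12

/-- **A v1.2 (⁗-KEYED) PACKAGE READS THE STOREY ALONG `Provisos₁₃Sep.toSepMixed`** (same datum, node00-def-T's `datumOfRecord₁₃SepMixed_toSepMixed_sep : rfl`): from the DEPRECATED,
print-STRONGER v1.2 proviso `h : θ.Provisos₁₃Sep F N` (bg over the separated support) plus the two v1.3 numerics letters `hM` ([III] p.245 «M = L^m») and `hM₁` (`M₁ ∣ M`), the v1.3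
record of `datumOfRecord₁₃Sep F N θ h` with `Dag.B15_main` at every run — the one-way map v1.2 ⇒ v1.3 for consumers still holding a ⁗ package. [cite: Balaban1989LargeFieldII, Thm 1 + (0.1) pp.355–356; Balaban1988Convergent, p.245 (M = L^m); Balaban1989LargeFieldI, (0.2) p.176 (bookkeeping)] -/
theorem exists_record₁₃CSepMixed_pinWWorld_b15_main_of_leafOfRecord_toSepMixed_sep (h : θ.Provisos₁₃Sep F N) (hM : ∃ a : ℕ, θ.τ9.M = F.L ^ a) (hM₁ : θ.ν.M₁ ∣ θ.τ9.M)
    (hθ : θ.Admissible F N) (lamW : ResidW F N) {γw : ℝ} (hγw : 0 < γw ∧ γw ≤ θ.γ) (h12 : ∀ P, B15Leaf (WOfRecord₁₃ F N θ lamW P)) :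
    ∃ w : WorldP, IsRecordOfRecord₁₃CSepMixed F N (datumOfRecord₁₃Sep F N θ h) w ∧ w.γ = γw ∧ w.L = (θ.L : ℝ) ∧
      (∀ P, w.up P = upOfRecord₅C F N ((θ.pinW F N (WOfRecord₁₃ F N θ lamW)).toStage5₁₃ F N) P) ∧ ∀ P : B12.RunParams, Dag.B15_main (leavesP w P) :=
  exists_record₁₃CSepMixed_pinWWorld_b15_main_of_leafOfRecord θ (h.toSepMixed hM hM₁) hθ lamW hγw h12

end Storey

section LiveStorey
variable (Θ : Stage13Params F N) (lamW : ResidW F N)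

/-- **★ N12's v1.3 STOREY AT THE ₁₃ LIVE RE-PIN OF A PARAMETER CARRYING K0b's RESIDUALS, N12's ROW FROM ITS PER-RUN DISPLAYS** (W read at the bundle of record
`WOfRecord₁₃ (Θ.liveRepin₁₃) λ`; the row by 12E's ★★ `b15Leaf_WOfRecord₁₃_liveRepin₁₃_all_of_massLive_of_hasResiduals`: below the torus the (1.100) pin equation + «every LIVE pre-𝐑 term at
level `kSel P + 1` has positive mass» + Prop. 1 (1.78) + (1.80) + (1.89); on runs with `K ≤ kSel P` the leaf handed).  K1-side input: `h : Provisos₁₃SepMixed` at the re-pin (for the datum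
and the record predicate ONLY) and admissibility. [cite: Balaban1989LargeFieldI, (0.2)–(0.6) p.176, p.176 ll.14–16, Prop. 1 (1.78) p.194, (1.80) p.195, (1.89) p.198, (1.99)–(1.102) pp.200–201; Balaban1988Convergent, (3.16) p.268, (3.22)–(3.25) pp.269–270; Balaban1989LargeFieldII, Thm 1 + (0.1) pp.355–356] -/
theorem exists_record₁₃CSepMixed_pinWWorld_b15_main_liveRepin₁₃_of_massLive_of_hasResiduals (hres : Θ.HasResidualsOfRecord F N)
    (h : (Θ.liveRepin₁₃ F N).Provisos₁₃SepMixed F N) (hθ : Θ.Admissible F N) {γw : ℝ} (hγw : 0 < γw ∧ γw ≤ Θ.γ)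
    (h12deg : ∀ P : B12.RunParams, P.K ≤ lamW.kSel P → B15Leaf (WOfRecord₁₃ F N (Θ.liveRepin₁₃ F N) lamW P))
    (h12pin : ∀ P : B12.RunParams, lamW.kSel P < P.K → lamW.D1100 P
      = rPrimeDataOfSel (reprTOfRecord₁₃ F N (Θ.liveRepin₁₃ F N) P (lamW.kSel P))
          ((Θ.liveRepin₁₃ F N).ppSel P (gOfRecord₁₃ F N (Θ.liveRepin₁₃ F N) P) (lamW.kSel P + 1))
          (fibOfSeq F (Θ.liveRepin₁₃ F N).ν (Θ.liveRepin₁₃ F N).τ9 P (gOfRecord₁₃ F N (Θ.liveRepin₁₃ F N) P) (lamW.kSel P + 1)))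
    (h12mass : ∀ P : B12.RunParams, lamW.kSel P < P.K → ∀ s, LiveSeq F N Θ.ν Θ.τ9 P (gOfRecord₁₃ F N (Θ.liveRepin₁₃ F N) P) (lamW.kSel P + 1)
        (slotsTOfRecord F N Θ.ν Θ.τ9 (EOfRecord₁₃ F N (Θ.liveRepin₁₃ F N)) (wOfRecord₉ F N (Θ.liveRepin₁₃ F N).toStage9Params)
          (Θ.liveRepin₁₃ F N).ppSel P (gOfRecord₁₃ F N (Θ.liveRepin₁₃ F N) P) (lamW.kSel P + 1)) s →
      0 < ∫ V, rterm (reprTOfRecord₁₃ F N (Θ.liveRepin₁₃ F N) P (lamW.kSel P)) s V ∂(fieldMeasure (F.P P.K) (lamW.kSel P + 1) (SU N)))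
    (h12P1 : ∀ P : B12.RunParams, lamW.kSel P < P.K → Prop1Printed (lamW.LF P))
    (h12i180 : ∀ P : B12.RunParams, lamW.kSel P < P.K → ∀ U, new189 (lamW.D189 P) U → ∀ i, (lamW.D189 P).h ≤ i → i ≤ (lamW.D189 P).k →
      ∀ q ∈ plaqsOf (dom (lamW.D189 P) i),
        Ineq180 ((lamW.D189 P).dev0 U q) ((lamW.D189 P).ε (lamW.D189 P).k) (lamW.D189 P).η (lamW.D189 P).B₃ (lamW.D189 P).B₅ (lamW.D189 P).M (lamW.D189 P).δ
          ((lamW.D189 P).dist q) (lamW.D189 P).O1)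
    (h12c189 : ∀ P : B12.RunParams, lamW.kSel P < P.K → Claim189 (new189 (lamW.D189 P)) (chiPP (lamW.D189 P))) :
    ∃ w : WorldP, IsRecordOfRecord₁₃CSepMixed F N (datumOfRecord₁₃SepMixed F N (Θ.liveRepin₁₃ F N) h) w ∧ w.γ = γw ∧ w.L = ((Θ.liveRepin₁₃ F N).L : ℝ) ∧
      (∀ P, w.up P = upOfRecord₅C F N (((Θ.liveRepin₁₃ F N).pinW F N (WOfRecord₁₃ F N (Θ.liveRepin₁₃ F N) lamW)).toStage5₁₃ F N) P) ∧
        ∀ P : B12.RunParams, Dag.B15_main (leavesP w P) :=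
  exists_record₁₃CSepMixed_pinWWorld_b15_main_of_leafOfRecord (Θ.liveRepin₁₃ F N) h hθ.liveRepin₁₃ lamW hγw
    (N12AtRecord13OfResiduals.b15Leaf_WOfRecord₁₃_liveRepin₁₃_all_of_massLive_of_hasResiduals Θ lamW hres h12deg h12pin h12mass h12P1 h12i180 h12c189)

/-- **★★ THE RUNG-1 SHAPE OF THE K1 SKELETON (plan g67 `K1Skeleton13Sep.stub_nodes13P` under the v1.3 token map), N12's CONJUNCT ONLY, WITNESSED BY `(Θ.liveRepin₁₃, h, w)` — GUARD AND N12's ROW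
THEOREMS OF K0b's RESIDUALS + N12's PER-RUN DISPLAYS**: `∃ θ' h' w, (ZtUnity ∧ SlotsNondegenerate₁₃) ∧ Admissible ∧ IsRecordOfRecord₁₃CSepMixed (datumOfRecord₁₃SepMixed θ' h') w ∧ ∀ P, Dag.B15_main (leavesP w P)`;
the guard by K0b ∕ K0a (`HasResidualsOfRecord.ztUnity`, FILE 9 v1.1 `slotsNondegenerate₁₃_liveRepin_of_hasResiduals` — NO proviso read).  N12 ALONE at its own world (the joint rung needs all
thirteen nodes at ONE world: §4's four-pin sockets ∕ dag-n24-c's engine); NOT the stub; count-neutral. [cite: Balaban1989LargeFieldI, (0.2)–(0.6) p.176, Prop. 1 (1.78) p.194, (1.80) p.195, (1.89) p.198, (1.99)–(1.102) pp.200–201; Balaban1988Convergent, (3.16)–(3.22) pp.268–269 (the guard); Balaban1989LargeFieldII, Thm 1 + (0.1) pp.355–356 (bookkeeping)] -/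
theorem exists_guarded_record₁₃CSepMixed_b15_main_liveRepin₁₃_of_massLive_of_hasResiduals (hres : Θ.HasResidualsOfRecord F N)
    (h : (Θ.liveRepin₁₃ F N).Provisos₁₃SepMixed F N) (hθ : Θ.Admissible F N)
    (h12deg : ∀ P : B12.RunParams, P.K ≤ lamW.kSel P → B15Leaf (WOfRecord₁₃ F N (Θ.liveRepin₁₃ F N) lamW P))
    (h12pin : ∀ P : B12.RunParams, lamW.kSel P < P.K → lamW.D1100 P
      = rPrimeDataOfSel (reprTOfRecord₁₃ F N (Θ.liveRepin₁₃ F N) P (lamW.kSel P))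
          ((Θ.liveRepin₁₃ F N).ppSel P (gOfRecord₁₃ F N (Θ.liveRepin₁₃ F N) P) (lamW.kSel P + 1))
          (fibOfSeq F (Θ.liveRepin₁₃ F N).ν (Θ.liveRepin₁₃ F N).τ9 P (gOfRecord₁₃ F N (Θ.liveRepin₁₃ F N) P) (lamW.kSel P + 1)))
    (h12mass : ∀ P : B12.RunParams, lamW.kSel P < P.K → ∀ s, LiveSeq F N Θ.ν Θ.τ9 P (gOfRecord₁₃ F N (Θ.liveRepin₁₃ F N) P) (lamW.kSel P + 1)
        (slotsTOfRecord F N Θ.ν Θ.τ9 (EOfRecord₁₃ F N (Θ.liveRepin₁₃ F N)) (wOfRecord₉ F N (Θ.liveRepin₁₃ F N).toStage9Params)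
          (Θ.liveRepin₁₃ F N).ppSel P (gOfRecord₁₃ F N (Θ.liveRepin₁₃ F N) P) (lamW.kSel P + 1)) s →
      0 < ∫ V, rterm (reprTOfRecord₁₃ F N (Θ.liveRepin₁₃ F N) P (lamW.kSel P)) s V ∂(fieldMeasure (F.P P.K) (lamW.kSel P + 1) (SU N)))
    (h12P1 : ∀ P : B12.RunParams, lamW.kSel P < P.K → Prop1Printed (lamW.LF P))
    (h12i180 : ∀ P : B12.RunParams, lamW.kSel P < P.K → ∀ U, new189 (lamW.D189 P) U → ∀ i, (lamW.D189 P).h ≤ i → i ≤ (lamW.D189 P).k →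
      ∀ q ∈ plaqsOf (dom (lamW.D189 P) i),
        Ineq180 ((lamW.D189 P).dev0 U q) ((lamW.D189 P).ε (lamW.D189 P).k) (lamW.D189 P).η (lamW.D189 P).B₃ (lamW.D189 P).B₅ (lamW.D189 P).M (lamW.D189 P).δ
          ((lamW.D189 P).dist q) (lamW.D189 P).O1)
    (h12c189 : ∀ P : B12.RunParams, lamW.kSel P < P.K → Claim189 (new189 (lamW.D189 P)) (chiPP (lamW.D189 P))) :
    ∃ (θ' : Stage13Params F N) (h' : θ'.Provisos₁₃SepMixed F N) (w : WorldP), (θ'.ZtUnity F N ∧ θ'.SlotsNondegenerate₁₃ F N) ∧ θ'.Admissible F N ∧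
      IsRecordOfRecord₁₃CSepMixed F N (datumOfRecord₁₃SepMixed F N θ' h') w ∧ ∀ P : B12.RunParams, Dag.B15_main (leavesP w P) := by
  obtain ⟨w, hR, -, -, -, hN⟩ := exists_record₁₃CSepMixed_pinWWorld_b15_main_liveRepin₁₃_of_massLive_of_hasResiduals Θ lamW hres h hθ
    ⟨hθ.toStage9.gamma_pos, le_rfl⟩ h12deg h12pin h12mass h12P1 h12i180 h12c189
  exact ⟨Θ.liveRepin₁₃ F N, h, w, ⟨Stage13Params.ZtUnity.liveRepin₁₃ hres.ztUnity, Stage13Params.slotsNondegenerate₁₃_liveRepin_of_hasResiduals hres⟩,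
    hθ.liveRepin₁₃, hR, hN⟩

end LiveStorey

section Thm1CStorey
variable (ε₀ ε₂₉ B₃ a₀ a₁ : ℝ) (lamW : ResidW F N)

/-- **★★★ THE RUNG-1 SHAPE OF THE K1 SKELETON (under the v1.3 token map), N12's CONJUNCT ONLY, AT THE PLAN's `L`-KEYED WITNESS `θ₁₅ᶜ = theta13OfThm1C F N ε₀ ε₂₉ B₃ a₀ a₁`** (§3 at
`Θ := theta13OfNumerics … (stage12NumericsOfThm1C F.L ε₀ B₃ a₀ a₁) …`, whose ₁₃ live re-pin IS `θ₁₅ᶜ`; K0b's residuals of record by K0a's `hasResidualsOfRecord_theta13OfNumerics`,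
admissibility by K0a's `admissible_theta13OfNumerics` under the five witness signs): K1-SIDE INPUT = `h : Provisos₁₃SepMixed θ₁₅ᶜ` ALONE (read by the datum and the record predicate only);
N12's per-run displays as in 12E ∕ 12F ∕ 12G.  N12 ALONE at its own world; NOT the stub; count-neutral. [cite: Balaban1989LargeFieldI, (0.2)–(0.6) p.176, Prop. 1 (1.78) p.194, (1.80) p.195, (1.89) p.198, (1.99)–(1.102) pp.200–201; Balaban1988Convergent, (2.10) p.256, (3.16)–(3.22) pp.268–269; Balaban1989LargeFieldII, Thm 1 + (0.1) pp.355–356; Balaban1985Variational, Thm 1 p.279 (witness letters only)] -/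
theorem exists_guarded_record₁₃CSepMixed_b15_main_theta13OfThm1C_of_massLive (hε : 0 < ε₀) (hε' : 0 < ε₂₉) (hB : 0 ≤ B₃) (ha₀ : 0 < a₀) (ha₁ : 0 < a₁)
    (h : (theta13OfThm1C F N ε₀ ε₂₉ B₃ a₀ a₁).Provisos₁₃SepMixed F N)
    (h12deg : ∀ P : B12.RunParams, P.K ≤ lamW.kSel P → B15Leaf (WOfRecord₁₃ F N (theta13OfThm1C F N ε₀ ε₂₉ B₃ a₀ a₁) lamW P))
    (h12pin : ∀ P : B12.RunParams, lamW.kSel P < P.K → lamW.D1100 P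
      = rPrimeDataOfSel (reprTOfRecord₁₃ F N (theta13OfThm1C F N ε₀ ε₂₉ B₃ a₀ a₁) P (lamW.kSel P))
          ((theta13OfThm1C F N ε₀ ε₂₉ B₃ a₀ a₁).ppSel P (gOfRecord₁₃ F N (theta13OfThm1C F N ε₀ ε₂₉ B₃ a₀ a₁) P) (lamW.kSel P + 1))
          (fibOfSeq F (theta13OfThm1C F N ε₀ ε₂₉ B₃ a₀ a₁).ν (theta13OfThm1C F N ε₀ ε₂₉ B₃ a₀ a₁).τ9 P (gOfRecord₁₃ F N (theta13OfThm1C F N ε₀ ε₂₉ B₃ a₀ a₁) P) (lamW.kSel P + 1)))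
    (h12mass : ∀ P : B12.RunParams, lamW.kSel P < P.K → ∀ s, LiveSeq F N (theta13OfThm1C F N ε₀ ε₂₉ B₃ a₀ a₁).ν (theta13OfThm1C F N ε₀ ε₂₉ B₃ a₀ a₁).τ9 P (gOfRecord₁₃ F N (theta13OfThm1C F N ε₀ ε₂₉ B₃ a₀ a₁) P) (lamW.kSel P + 1)
        (slotsTOfRecord F N (theta13OfThm1C F N ε₀ ε₂₉ B₃ a₀ a₁).ν (theta13OfThm1C F N ε₀ ε₂₉ B₃ a₀ a₁).τ9 (EOfRecord₁₃ F N (theta13OfThm1C F N ε₀ ε₂₉ B₃ a₀ a₁)) (wOfRecord₉ F N (theta13OfThm1C F N ε₀ ε₂₉ B₃ a₀ a₁).toStage9Params)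
          (theta13OfThm1C F N ε₀ ε₂₉ B₃ a₀ a₁).ppSel P (gOfRecord₁₃ F N (theta13OfThm1C F N ε₀ ε₂₉ B₃ a₀ a₁) P) (lamW.kSel P + 1)) s →
      0 < ∫ V, rterm (reprTOfRecord₁₃ F N (theta13OfThm1C F N ε₀ ε₂₉ B₃ a₀ a₁) P (lamW.kSel P)) s V ∂(fieldMeasure (F.P P.K) (lamW.kSel P + 1) (SU N)))
    (h12P1 : ∀ P : B12.RunParams, lamW.kSel P < P.K → Prop1Printed (lamW.LF P))
    (h12i180 : ∀ P : B12.RunParams, lamW.kSel P < P.K → ∀ U, new189 (lamW.D189 P) U → ∀ i, (lamW.D189 P).h ≤ i → i ≤ (lamW.D189 P).k →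
      ∀ q ∈ plaqsOf (dom (lamW.D189 P) i),
        Ineq180 ((lamW.D189 P).dev0 U q) ((lamW.D189 P).ε (lamW.D189 P).k) (lamW.D189 P).η (lamW.D189 P).B₃ (lamW.D189 P).B₅ (lamW.D189 P).M (lamW.D189 P).δ
          ((lamW.D189 P).dist q) (lamW.D189 P).O1)
    (h12c189 : ∀ P : B12.RunParams, lamW.kSel P < P.K → Claim189 (new189 (lamW.D189 P)) (chiPP (lamW.D189 P))) :
    ∃ (θ' : Stage13Params F N) (h' : θ'.Provisos₁₃SepMixed F N) (w : WorldP), (θ'.ZtUnity F N ∧ θ'.SlotsNondegenerate₁₃ F N) ∧ θ'.Admissible F N ∧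
      IsRecordOfRecord₁₃CSepMixed F N (datumOfRecord₁₃SepMixed F N θ' h') w ∧ ∀ P : B12.RunParams, Dag.B15_main (leavesP w P) :=
  exists_guarded_record₁₃CSepMixed_b15_main_liveRepin₁₃_of_massLive_of_hasResiduals
    (theta13OfNumerics F N (stage12NumericsOfThm1C F.L ε₀ B₃ a₀ a₁) ε₂₉
      (zeta316OfRecord F N (stage12NumericsOfThm1C F.L ε₀ B₃ a₀ a₁).ν (stage12NumericsOfThm1C F.L ε₀ B₃ a₀ a₁).τ9.M (stage12NumericsOfThm1C F.L ε₀ B₃ a₀ a₁).A₁)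
      (RzOfRecord F N) (ZtOfRecord F N)) lamW
    (hasResidualsOfRecord_theta13OfNumerics F N (stage12NumericsOfThm1C F.L ε₀ B₃ a₀ a₁) ε₂₉) h
    (admissible_theta13OfNumerics F N (zeta316OfRecord F N (stage12NumericsOfThm1C F.L ε₀ B₃ a₀ a₁).ν (stage12NumericsOfThm1C F.L ε₀ B₃ a₀ a₁).τ9.M
      (stage12NumericsOfThm1C F.L ε₀ B₃ a₀ a₁).A₁) (RzOfRecord F N) (ZtOfRecord F N) (stage12NumericsOfThm1C_pos hε hB ha₀ ha₁) hε')
    h12deg h12pin h12mass h12P1 h12i180 h12c189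

end Thm1CStorey

/-! ## §3 THE MIXED W-PIN — THE BUNDLE OF RECORD BELOW THE TORUS, A DEGENERATE LEAF-CARRIER ON RUNS WHOSE SELECTED STEP IS NOT A PRINTED STEP (`P.K ≤ λ.kSel P`):
N12's storey and its rung-1 shape WITHOUT the `K ≤ kSel P` leaf (new in the ⁵ edition; N12-only — the four-pin sockets keep dag-n10-d's W-pinned view and hence the handed leaf) -/

section BelowTorus
variable (θ : Stage13Params F N)

/-- **THE MIXED W-PIN ENGINE**: for every admissible Stage-13 package with the v1.3 provisos and every residual layer `λ` whose bundle of record carries the leaf on the runs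
`P` with `λ.kSel P < P.K` (the runs where step `λ.kSel P` IS one of print's `K` steps), there is a run-indexed [IV] bundle family `W₀` AGREEING WITH THE BUNDLE OF RECORD
`WOfRecord₁₃ θ λ P` ON THOSE RUNS, carrying the leaf at every run, whose W-pinned world is a v1.3 record of `datumOfRecord₁₃SepMixed θ h` with `Dag.B15_main` at every run.  On the
other runs (`P.K ≤ λ.kSel P`: the selected step is not a step of the run — at `K = 0` there is none) `W₀ P` is the degenerate leaf-carrier of this seat's g4
`exists_printedCarriers15_b15Leaf`, where print applies no basic step and the typed leaf would read junk levels of the K-blind tower recursion.  HONESTY: this removes a junk demand,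
not a printed one; the per-run cost below the torus is unchanged. [cite: Balaban1989LargeFieldI, (0.1)–(0.6) pp.175–176 (the basic step is applied at the steps `k < K` of a run), Prop. 1 p.194; Balaban1989LargeFieldII, Thm 1 + (0.1) pp.355–356 (bookkeeping)] -/
theorem exists_mixedPinW_record₁₃CSepMixed_b15_main_of_leafBelow (h : θ.Provisos₁₃SepMixed F N) (hθ : θ.Admissible F N) (lamW : ResidW F N)
    {γw : ℝ} (hγw : 0 < γw ∧ γw ≤ θ.γ) (h12 : ∀ P : B12.RunParams, lamW.kSel P < P.K → B15Leaf (WOfRecord₁₃ F N θ lamW P)) :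
    ∃ W₀ : B12.RunParams → PrintedCarriers15, (∀ P : B12.RunParams, lamW.kSel P < P.K → W₀ P = WOfRecord₁₃ F N θ lamW P) ∧ (∀ P, B15Leaf (W₀ P)) ∧
      ∃ w : WorldP, IsRecordOfRecord₁₃CSepMixed F N (datumOfRecord₁₃SepMixed F N θ h) w ∧ w.γ = γw ∧ w.L = (θ.L : ℝ) ∧
        (∀ P, w.up P = upOfRecord₅C F N ((θ.pinW F N W₀).toStage5₁₃ F N) P) ∧ ∀ P : B12.RunParams, Dag.B15_main (leavesP w P) := by
  obtain ⟨Wd, hWd⟩ := N12AtRecord12Pointed.exists_printedCarriers15_b15Leaf (F.P 0)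
  have hleaf : ∀ P : B12.RunParams, B15Leaf ((fun P : B12.RunParams => if lamW.kSel P < P.K then WOfRecord₁₃ F N θ lamW P else Wd) P) := fun P => by
    dsimp only
    split_ifs with hP
    exacts [h12 P hP, hWd]
  exact ⟨_, fun P hP => if_pos hP, hleaf, exists_record₁₃CSepMixed_pinWWorld_b15_main_of_leaf θ h hθ _ hγw hleaf⟩

end BelowTorus

section BelowTorusLive
variable (Θ : Stage13Params F N) (lamW : ResidW F N)

/-- **★ N12's v1.3 STOREY AT THE ₁₃ LIVE RE-PIN, MIXED W-PIN — NO `K ≤ kSel P` LEAF**: at the live re-pin of a `Θ` carrying K0b's residuals, N12's row on the runs below the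
torus from 12E's per-run ★★ `b15Leaf_WOfRecord₁₃_liveRepin₁₃_of_massLive_of_hasResiduals` (pin equation + live-mass + Prop. 1 (1.78) + (1.80) + (1.89)), the other runs served by
the degenerate carrier (§3 engine).  K1-side input: `h : Provisos₁₃SepMixed` at the re-pin (datum ∕ record predicate only) and admissibility. [cite: Balaban1989LargeFieldI, (0.2)–(0.6) p.176, p.176 ll.14–16, Prop. 1 (1.78) p.194, (1.80) p.195, (1.89) p.198, (1.99)–(1.102) pp.200–201; Balaban1988Convergent, (3.16) p.268, (3.22)–(3.25) pp.269–270; Balaban1989LargeFieldII, Thm 1 + (0.1) pp.355–356] -/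
theorem exists_mixedPinW_record₁₃CSepMixed_b15_main_liveRepin₁₃_of_massLive_of_hasResiduals (hres : Θ.HasResidualsOfRecord F N)
    (h : (Θ.liveRepin₁₃ F N).Provisos₁₃SepMixed F N) (hθ : Θ.Admissible F N) {γw : ℝ} (hγw : 0 < γw ∧ γw ≤ Θ.γ)
    (h12pin : ∀ P : B12.RunParams, lamW.kSel P < P.K → lamW.D1100 P
      = rPrimeDataOfSel (reprTOfRecord₁₃ F N (Θ.liveRepin₁₃ F N) P (lamW.kSel P))
          ((Θ.liveRepin₁₃ F N).ppSel P (gOfRecord₁₃ F N (Θ.liveRepin₁₃ F N) P) (lamW.kSel P + 1))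
          (fibOfSeq F (Θ.liveRepin₁₃ F N).ν (Θ.liveRepin₁₃ F N).τ9 P (gOfRecord₁₃ F N (Θ.liveRepin₁₃ F N) P) (lamW.kSel P + 1)))
    (h12mass : ∀ P : B12.RunParams, lamW.kSel P < P.K → ∀ s, LiveSeq F N Θ.ν Θ.τ9 P (gOfRecord₁₃ F N (Θ.liveRepin₁₃ F N) P) (lamW.kSel P + 1)
        (slotsTOfRecord F N Θ.ν Θ.τ9 (EOfRecord₁₃ F N (Θ.liveRepin₁₃ F N)) (wOfRecord₉ F N (Θ.liveRepin₁₃ F N).toStage9Params)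
          (Θ.liveRepin₁₃ F N).ppSel P (gOfRecord₁₃ F N (Θ.liveRepin₁₃ F N) P) (lamW.kSel P + 1)) s →
      0 < ∫ V, rterm (reprTOfRecord₁₃ F N (Θ.liveRepin₁₃ F N) P (lamW.kSel P)) s V ∂(fieldMeasure (F.P P.K) (lamW.kSel P + 1) (SU N)))
    (h12P1 : ∀ P : B12.RunParams, lamW.kSel P < P.K → Prop1Printed (lamW.LF P))
    (h12i180 : ∀ P : B12.RunParams, lamW.kSel P < P.K → ∀ U, new189 (lamW.D189 P) U → ∀ i, (lamW.D189 P).h ≤ i → i ≤ (lamW.D189 P).k →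
      ∀ q ∈ plaqsOf (dom (lamW.D189 P) i),
        Ineq180 ((lamW.D189 P).dev0 U q) ((lamW.D189 P).ε (lamW.D189 P).k) (lamW.D189 P).η (lamW.D189 P).B₃ (lamW.D189 P).B₅ (lamW.D189 P).M (lamW.D189 P).δ
          ((lamW.D189 P).dist q) (lamW.D189 P).O1)
    (h12c189 : ∀ P : B12.RunParams, lamW.kSel P < P.K → Claim189 (new189 (lamW.D189 P)) (chiPP (lamW.D189 P))) :
    ∃ W₀ : B12.RunParams → PrintedCarriers15, (∀ P : B12.RunParams, lamW.kSel P < P.K → W₀ P = WOfRecord₁₃ F N (Θ.liveRepin₁₃ F N) lamW P) ∧ (∀ P, B15Leaf (W₀ P)) ∧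
      ∃ w : WorldP, IsRecordOfRecord₁₃CSepMixed F N (datumOfRecord₁₃SepMixed F N (Θ.liveRepin₁₃ F N) h) w ∧ w.γ = γw ∧ w.L = ((Θ.liveRepin₁₃ F N).L : ℝ) ∧
        (∀ P, w.up P = upOfRecord₅C F N (((Θ.liveRepin₁₃ F N).pinW F N W₀).toStage5₁₃ F N) P) ∧ ∀ P : B12.RunParams, Dag.B15_main (leavesP w P) :=
  exists_mixedPinW_record₁₃CSepMixed_b15_main_of_leafBelow (Θ.liveRepin₁₃ F N) h hθ.liveRepin₁₃ lamW hγw fun P hk =>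
    N12AtRecord13OfResiduals.b15Leaf_WOfRecord₁₃_liveRepin₁₃_of_massLive_of_hasResiduals Θ lamW hres hk (h12pin P hk) (h12mass P hk) (h12P1 P hk)
      (h12i180 P hk) (h12c189 P hk)

/-- **★★ THE RUNG-1 SHAPE, N12's CONJUNCT ONLY, WITNESSED BY `(Θ.liveRepin₁₃, h, w)` — NO `K ≤ kSel P` LEAF** (§2's ★★ with the handed leaf REMOVED by the mixed W-pin: the conclusion
never names `W`).  Guard a THEOREM of K0b ∕ K0a FILE 9 v1.1; N12's per-run displays below the torus only. [cite: Balaban1989LargeFieldI, (0.2)–(0.6) p.176, Prop. 1 (1.78) p.194, (1.80) p.195, (1.89) p.198, (1.99)–(1.102) pp.200–201; Balaban1988Convergent, (3.16)–(3.22) pp.268–269 (the guard); Balaban1989LargeFieldII, Thm 1 + (0.1) pp.355–356 (bookkeeping)] -/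
theorem exists_guarded_record₁₃CSepMixed_b15_main_liveRepin₁₃_of_massLive_of_hasResiduals_below (hres : Θ.HasResidualsOfRecord F N)
    (h : (Θ.liveRepin₁₃ F N).Provisos₁₃SepMixed F N) (hθ : Θ.Admissible F N)
    (h12pin : ∀ P : B12.RunParams, lamW.kSel P < P.K → lamW.D1100 P
      = rPrimeDataOfSel (reprTOfRecord₁₃ F N (Θ.liveRepin₁₃ F N) P (lamW.kSel P))
          ((Θ.liveRepin₁₃ F N).ppSel P (gOfRecord₁₃ F N (Θ.liveRepin₁₃ F N) P) (lamW.kSel P + 1))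
          (fibOfSeq F (Θ.liveRepin₁₃ F N).ν (Θ.liveRepin₁₃ F N).τ9 P (gOfRecord₁₃ F N (Θ.liveRepin₁₃ F N) P) (lamW.kSel P + 1)))
    (h12mass : ∀ P : B12.RunParams, lamW.kSel P < P.K → ∀ s, LiveSeq F N Θ.ν Θ.τ9 P (gOfRecord₁₃ F N (Θ.liveRepin₁₃ F N) P) (lamW.kSel P + 1)
        (slotsTOfRecord F N Θ.ν Θ.τ9 (EOfRecord₁₃ F N (Θ.liveRepin₁₃ F N)) (wOfRecord₉ F N (Θ.liveRepin₁₃ F N).toStage9Params)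
          (Θ.liveRepin₁₃ F N).ppSel P (gOfRecord₁₃ F N (Θ.liveRepin₁₃ F N) P) (lamW.kSel P + 1)) s →
      0 < ∫ V, rterm (reprTOfRecord₁₃ F N (Θ.liveRepin₁₃ F N) P (lamW.kSel P)) s V ∂(fieldMeasure (F.P P.K) (lamW.kSel P + 1) (SU N)))
    (h12P1 : ∀ P : B12.RunParams, lamW.kSel P < P.K → Prop1Printed (lamW.LF P))
    (h12i180 : ∀ P : B12.RunParams, lamW.kSel P < P.K → ∀ U, new189 (lamW.D189 P) U → ∀ i, (lamW.D189 P).h ≤ i → i ≤ (lamW.D189 P).k →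
      ∀ q ∈ plaqsOf (dom (lamW.D189 P) i),
        Ineq180 ((lamW.D189 P).dev0 U q) ((lamW.D189 P).ε (lamW.D189 P).k) (lamW.D189 P).η (lamW.D189 P).B₃ (lamW.D189 P).B₅ (lamW.D189 P).M (lamW.D189 P).δ
          ((lamW.D189 P).dist q) (lamW.D189 P).O1)
    (h12c189 : ∀ P : B12.RunParams, lamW.kSel P < P.K → Claim189 (new189 (lamW.D189 P)) (chiPP (lamW.D189 P))) :
    ∃ (θ' : Stage13Params F N) (h' : θ'.Provisos₁₃SepMixed F N) (w : WorldP), (θ'.ZtUnity F N ∧ θ'.SlotsNondegenerate₁₃ F N) ∧ θ'.Admissible F N ∧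
      IsRecordOfRecord₁₃CSepMixed F N (datumOfRecord₁₃SepMixed F N θ' h') w ∧ ∀ P : B12.RunParams, Dag.B15_main (leavesP w P) := by
  obtain ⟨-, -, -, w, hR, -, -, -, hN⟩ := exists_mixedPinW_record₁₃CSepMixed_b15_main_liveRepin₁₃_of_massLive_of_hasResiduals Θ lamW hres h hθ
    ⟨hθ.toStage9.gamma_pos, le_rfl⟩ h12pin h12mass h12P1 h12i180 h12c189
  exact ⟨Θ.liveRepin₁₃ F N, h, w, ⟨Stage13Params.ZtUnity.liveRepin₁₃ hres.ztUnity, Stage13Params.slotsNondegenerate₁₃_liveRepin_of_hasResiduals hres⟩,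
    hθ.liveRepin₁₃, hR, hN⟩

end BelowTorusLive

section BelowTorusThm1C
variable (ε₀ ε₂₉ B₃ a₀ a₁ : ℝ) (lamW : ResidW F N)

/-- **★★★ THE RUNG-1 SHAPE, N12's CONJUNCT ONLY, AT THE PLAN's WITNESS `θ₁₅ᶜ = theta13OfThm1C F N ε₀ ε₂₉ B₃ a₀ a₁` — NO `K ≤ kSel P` LEAF** (§2's ★★★ with the handed leaf REMOVED):
K1-side input `h : Provisos₁₃SepMixed θ₁₅ᶜ` ALONE; N12's per-run displays below the torus only.  (The witness CLASS caveat of referee PLACEMENT-21 ∕ director №146 — live selector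
with `εreg = a₀` — concerns the K1 consequent, not this N12-only shape; §3's ★★ is generic in `Θ` and re-pins to any successor family by instantiation.) [cite: Balaban1989LargeFieldI, (0.2)–(0.6) p.176, Prop. 1 (1.78) p.194, (1.80) p.195, (1.89) p.198, (1.99)–(1.102) pp.200–201; Balaban1988Convergent, (2.10) p.256, (3.16)–(3.22) pp.268–269; Balaban1989LargeFieldII, Thm 1 + (0.1) pp.355–356; Balaban1985Variational, Thm 1 p.279 (witness letters only)] -/
theorem exists_guarded_record₁₃CSepMixed_b15_main_theta13OfThm1C_of_massLive_below (hε : 0 < ε₀) (hε' : 0 < ε₂₉) (hB : 0 ≤ B₃) (ha₀ : 0 < a₀) (ha₁ : 0 < a₁)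
    (h : (theta13OfThm1C F N ε₀ ε₂₉ B₃ a₀ a₁).Provisos₁₃SepMixed F N)
    (h12pin : ∀ P : B12.RunParams, lamW.kSel P < P.K → lamW.D1100 P
      = rPrimeDataOfSel (reprTOfRecord₁₃ F N (theta13OfThm1C F N ε₀ ε₂₉ B₃ a₀ a₁) P (lamW.kSel P))
          ((theta13OfThm1C F N ε₀ ε₂₉ B₃ a₀ a₁).ppSel P (gOfRecord₁₃ F N (theta13OfThm1C F N ε₀ ε₂₉ B₃ a₀ a₁) P) (lamW.kSel P + 1))
          (fibOfSeq F (theta13OfThm1C F N ε₀ ε₂₉ B₃ a₀ a₁).ν (theta13OfThm1C F N ε₀ ε₂₉ B₃ a₀ a₁).τ9 P (gOfRecord₁₃ F N (theta13OfThm1C F N ε₀ ε₂₉ B₃ a₀ a₁) P) (lamW.kSel P + 1)))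
    (h12mass : ∀ P : B12.RunParams, lamW.kSel P < P.K → ∀ s, LiveSeq F N (theta13OfThm1C F N ε₀ ε₂₉ B₃ a₀ a₁).ν (theta13OfThm1C F N ε₀ ε₂₉ B₃ a₀ a₁).τ9 P (gOfRecord₁₃ F N (theta13OfThm1C F N ε₀ ε₂₉ B₃ a₀ a₁) P) (lamW.kSel P + 1)
        (slotsTOfRecord F N (theta13OfThm1C F N ε₀ ε₂₉ B₃ a₀ a₁).ν (theta13OfThm1C F N ε₀ ε₂₉ B₃ a₀ a₁).τ9 (EOfRecord₁₃ F N (theta13OfThm1C F N ε₀ ε₂₉ B₃ a₀ a₁)) (wOfRecord₉ F N (theta13OfThm1C F N ε₀ ε₂₉ B₃ a₀ a₁).toStage9Params)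
          (theta13OfThm1C F N ε₀ ε₂₉ B₃ a₀ a₁).ppSel P (gOfRecord₁₃ F N (theta13OfThm1C F N ε₀ ε₂₉ B₃ a₀ a₁) P) (lamW.kSel P + 1)) s →
      0 < ∫ V, rterm (reprTOfRecord₁₃ F N (theta13OfThm1C F N ε₀ ε₂₉ B₃ a₀ a₁) P (lamW.kSel P)) s V ∂(fieldMeasure (F.P P.K) (lamW.kSel P + 1) (SU N)))
    (h12P1 : ∀ P : B12.RunParams, lamW.kSel P < P.K → Prop1Printed (lamW.LF P))
    (h12i180 : ∀ P : B12.RunParams, lamW.kSel P < P.K → ∀ U, new189 (lamW.D189 P) U → ∀ i, (lamW.D189 P).h ≤ i → i ≤ (lamW.D189 P).k →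
      ∀ q ∈ plaqsOf (dom (lamW.D189 P) i),
        Ineq180 ((lamW.D189 P).dev0 U q) ((lamW.D189 P).ε (lamW.D189 P).k) (lamW.D189 P).η (lamW.D189 P).B₃ (lamW.D189 P).B₅ (lamW.D189 P).M (lamW.D189 P).δ
          ((lamW.D189 P).dist q) (lamW.D189 P).O1)
    (h12c189 : ∀ P : B12.RunParams, lamW.kSel P < P.K → Claim189 (new189 (lamW.D189 P)) (chiPP (lamW.D189 P))) :
    ∃ (θ' : Stage13Params F N) (h' : θ'.Provisos₁₃SepMixed F N) (w : WorldP), (θ'.ZtUnity F N ∧ θ'.SlotsNondegenerate₁₃ F N) ∧ θ'.Admissible F N ∧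
      IsRecordOfRecord₁₃CSepMixed F N (datumOfRecord₁₃SepMixed F N θ' h') w ∧ ∀ P : B12.RunParams, Dag.B15_main (leavesP w P) :=
  exists_guarded_record₁₃CSepMixed_b15_main_liveRepin₁₃_of_massLive_of_hasResiduals_below
    (theta13OfNumerics F N (stage12NumericsOfThm1C F.L ε₀ B₃ a₀ a₁) ε₂₉
      (zeta316OfRecord F N (stage12NumericsOfThm1C F.L ε₀ B₃ a₀ a₁).ν (stage12NumericsOfThm1C F.L ε₀ B₃ a₀ a₁).τ9.M (stage12NumericsOfThm1C F.L ε₀ B₃ a₀ a₁).A₁)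
      (RzOfRecord F N) (ZtOfRecord F N)) lamW
    (hasResidualsOfRecord_theta13OfNumerics F N (stage12NumericsOfThm1C F.L ε₀ B₃ a₀ a₁) ε₂₉) h
    (admissible_theta13OfNumerics F N (zeta316OfRecord F N (stage12NumericsOfThm1C F.L ε₀ B₃ a₀ a₁).ν (stage12NumericsOfThm1C F.L ε₀ B₃ a₀ a₁).τ9.M
      (stage12NumericsOfThm1C F.L ε₀ B₃ a₀ a₁).A₁) (RzOfRecord F N) (ZtOfRecord F N) (stage12NumericsOfThm1C_pos hε hB ha₀ ha₁) hε')
    h12pin h12mass h12P1 h12i180 h12c189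

end BelowTorusThm1C

end Summit.QuantumFields.YangMills.BalabanUVNodes.N12AtRecord13SepMixed
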